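import Mathlib
import Summits.ValiantsHypothesis.ValiantsHypothesis.Theorems.NewtonUnitEquationsTwoProductsPeelShallow
/-! # Stub `stub_engineLetterPredecessor` — crux `TwoProducts` (stmt-ValiantsHypothesis-5906), line `corner-log-linearization`
   The LETTER-PREDECESSOR RUNG of the engine.

   Setting: bivariate polynomials `u_i` (`i < k`), `v_j` (`j < m`) with every `v_j` of constant term `1`,
   a further polynomial `p`, the peeled unit-product power series `G = (∏ ↑u_i) * (∏ ↑v_j)⁻¹`, and the
   finite set `𝓛` of all *letters* (the union of the supports of all the factors `u_i`, `v_j`).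
   Hypothesis: every nonzero support point `e` of `G` has a *letter predecessor*, i.e. a letter
   `a ≠ 0` with `a ≤ e` componentwise and `e - a ∈ supp G`.  Conclusion: the set of south-west
   vertices of `D = ∏ u_i - p * ∏ v_j` (strict minimisers over `supp D` of a linear form with both
   weights positive) has at most `(|supp p| + 1)(|𝓛| + 1)` elements.

   Proof: by the peel–shallow reduction (`PeelShallow.stub_peelShallow`) a south-west vertex `e`
   (weight `w`) lies in `supp p`, or `G_e ≠ 0` and every support point `q ∉ {0, e}` of `G` that is
   `w`-lighter than or equal to `e` lies in `supp p`.  In the second case, if `e ≠ 0` take a letter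
   predecessor `a` of `e` and put `q = e - a`; then `e = q + a`, `q ≠ e` (as `a ≠ 0`) and
   `wt q = wt e - wt a ≤ wt e`; so either `q = 0` and `e = a ∈ 𝓛`, or `q ∈ supp p` and
   `e ∈ supp p + 𝓛`.  Hence the vertex set is contained in `{0} ∪ supp p ∪ 𝓛 ∪ (supp p + 𝓛)`, of
   cardinality `≤ 1 + |supp p| + |𝓛| + |supp p|·|𝓛| = (|supp p| + 1)(|𝓛| + 1)`. [folklore] -/
set_option linter.dupNamespace false -- single-conjunct summit: `ValiantsHypothesis.ValiantsHypothesis`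
namespace Summit.ValiantsHypothesis.ValiantsHypothesis.Theorems.TwoProducts.LetterPredecessor
open scoped BigOperators Pointwise
open Summit.ValiantsHypothesis.ValiantsHypothesis.Theorems.TwoProducts.DepthOne
open Summit.ValiantsHypothesis.ValiantsHypothesis.Theorems.TwoProducts.PeelShallow

/-- In `Fin 2 →₀ ℕ`: if `a ≤ e` and `e - a = e` then `a = 0`. [folklore] -/
theorem eq_zero_of_tsub_eq_self {a e : Fin 2 →₀ ℕ} (hae : a ≤ e) (h : e - a = e) : a = 0 := by
  have hqa : e - a + a = e := tsub_add_cancel_of_le hae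
  rw [h] at hqa
  exact add_eq_left.mp hqa

/-- **Letter-predecessor rung** (rung `stub_engineLetterPredecessor`, registered signature).  If every
nonzero support point of `G = (∏ ↑u_i) * (∏ ↑v_j)⁻¹` (all `v_j` of constant term `1`) has a letter
predecessor, then `∏ u_i - p * ∏ v_j` has at most `(|supp p| + 1)(|𝓛| + 1)` south-west vertices,
`𝓛` the set of all letters. [folklore] -/
theorem stub_engineLetterPredecessor : ∀ (k m : ℕ) (u : Fin k → MvPolynomial (Fin 2) ℂ) (v : Fin m → MvPolynomial (Fin 2) ℂ) (p : MvPolynomial (Fin 2) ℂ), (∀ j, MvPolynomial.coeff 0 (v j) = 1) → (∀ e : Fin 2 →₀ ℕ, e ≠ 0 → MvPowerSeries.coeff e ((∏ i, ((u i : MvPolynomial (Fin 2) ℂ) : MvPowerSeries (Fin 2) ℂ)) * (∏ j, ((v j : MvPolynomial (Fin 2) ℂ) : MvPowerSeries (Fin 2) ℂ))⁻¹) ≠ 0 → ∃ a ∈ ((Finset.univ.biUnion fun i => (u i).support) ∪ (Finset.univ.biUnion fun j => (v j).support)), a ≠ 0 ∧ a ≤ e ∧ MvPowerSeries.coeff (e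 - a) ((∏ i, ((u i : MvPolynomial (Fin 2) ℂ) : MvPowerSeries (Fin 2) ℂ)) * (∏ j, ((v j : MvPolynomial (Fin 2) ℂ) : MvPowerSeries (Fin 2) ℂ))⁻¹) ≠ 0) → {e : Fin 2 →₀ ℕ | ∃ w : Fin 2 → ℤ, 0 < w 0 ∧ 0 < w 1 ∧ e ∈ ((∏ i, u i) - p * ∏ j, v j).support ∧ ∀ e' ∈ ((∏ i, u i) - p * ∏ j, v j).support, e' ≠ e → w 0 * (e 0 : ℤ) + w 1 * (e 1 : ℤ) < w 0 * (e' 0 : ℤ) + w 1 * (e' 1 : ℤ)}.ncard ≤ (p.support.card + 1) * (((Finset.univ.biUnion fun i => (u i).support) ∪ (Finset.univ.biUnion fun j => (v j).support)).card + 1) := by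
  intro k m u v p hv hpred
  classical
  set L : Finset (Fin 2 →₀ ℕ) := (Finset.univ.biUnion fun i => (u i).support) ∪
    (Finset.univ.biUnion fun j => (v j).support) with hL
  set S : Finset (Fin 2 →₀ ℕ) := insert 0 (p.support ∪ L ∪ (p.support + L)) with hS
  -- every south-west vertex lies in `S`
  have hsub : {e : Fin 2 →₀ ℕ | ∃ w : Fin 2 → ℤ, 0 < w 0 ∧ 0 < w 1 ∧
      e ∈ ((∏ i, u i) - p * ∏ j, v j).support ∧ ∀ e' ∈ ((∏ i, u i) - p * ∏ j, v j).support,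
        e' ≠ e → w 0 * (e 0 : ℤ) + w 1 * (e 1 : ℤ) < w 0 * (e' 0 : ℤ) + w 1 * (e' 1 : ℤ)} ⊆ ↑S := by
    rintro e ⟨w, hw0, hw1, he, hmin⟩
    rw [Finset.mem_coe, hS, Finset.mem_insert, Finset.mem_union, Finset.mem_union]
    rcases stub_peelShallow k m u v p hv w hw0 hw1 e ⟨he, hmin⟩ with hA | ⟨hGe, hq⟩
    · exact Or.inr (Or.inl (Or.inl hA))
    · by_cases he0 : e = 0
      · exact Or.inl he0
      · obtain ⟨a, haL, ha0, hae, hGa⟩ := hpred e he0 hGe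
        have hqa : e - a + a = e := tsub_add_cancel_of_le hae
        by_cases hq0 : e - a = 0
        · -- `e = a` is a letter
          rw [hq0, zero_add] at hqa
          rw [← hqa]
          exact Or.inr (Or.inl (Or.inr haL))
        · -- `q = e - a` is a nonzero support point of `G`, lighter than `e`, hence in `supp p`
          have hqe : e - a ≠ e := fun h => ha0 (eq_zero_of_tsub_eq_self hae h)
          have hle : w 0 * ((e - a) 0 : ℤ) + w 1 * ((e - a) 1 : ℤ) ≤
              w 0 * (e 0 : ℤ) + w 1 * (e 1 : ℤ) := by
            have hsum := wt_add w (e - a) a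
            rw [hqa] at hsum
            have ha := wt_nonneg w hw0 hw1 a
            linarith
          have hqp : e - a ∈ p.support := hq (e - a) hq0 hqe hGa hle
          rw [← hqa]
          exact Or.inr (Or.inr (Finset.add_mem_add hqp haL))
  -- count
  calc _ ≤ (↑S : Set (Fin 2 →₀ ℕ)).ncard := Set.ncard_le_ncard hsub S.finite_toSet
    _ = S.card := Set.ncard_coe_finset S
    _ ≤ (p.support ∪ L ∪ (p.support + L)).card + 1 := Finset.card_insert_le _ _
    _ ≤ (p.support.card + L.card + p.support.card * L.card) + 1 := by
        gcongr
        calc (p.support ∪ L ∪ (p.support + L)).card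
            ≤ (p.support ∪ L).card + (p.support + L).card := Finset.card_union_le _ _
          _ ≤ (p.support.card + L.card) + p.support.card * L.card :=
            Nat.add_le_add (Finset.card_union_le _ _) Finset.card_add_le
    _ = (p.support.card + 1) * (L.card + 1) := by ring

end Summit.ValiantsHypothesis.ValiantsHypothesis.Theorems.TwoProducts.LetterPredecessor
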